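import Mathlib.NumberTheory.NumberField.CMField
import Mathlib.NumberTheory.NumberField.InfinitePlace.Embeddings
import Mathlib.Algebra.BigOperators.Group.Finset.Basic
import HarnessLib

/-!
# The unitary signature `(1, n−1)` at a split place: the frame CM type and the two block counts (RSZ bookkeeping, `n = 2`)

Topic `NumberTheory/ComplexMultiplication`; namespace `Literature.NumberTheory.ComplexMultiplication`.  Theorems only (no definition, no instance,
no notation, no named fact, no `sorry`).  Cell `hodgecm-mathlib` (D-0151), P6 «MOD programme» (crux hLiu418, `--supports`), organ (U1-d) «SIGNATURE COUNT AT A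
SPLIT PLACE» of the GEN census (LEAD F0P6-plan (g2) 21:08:06Z (1); A-p18 (g31)); consumer: the (S-T) socket ★
`HodgeTheory.RingAction.hsig_specialFibre_of_isSmoothProper` (A-p17 (g26), p846836), hypothesis `h1 : ∑ i ∈ s with residue (c i) = 1, m i = 1`.
HC_CM is proved only modulo the printed citations until rung 0 closes; nothing here is about HC.

THE MATHEMATICS ([RapoportSmithlingZhang2020Diagonal] §3.2 p. 10 (the generalized CM type `r` with `r_{φ₀} = 1`, `r_φ ∈ {0, n}` for `φ ≠ φ₀, φ̄₀`,
`r_φ + r_φ̄ = n`), §4.1 (4.6) p. 16 and p. 17 (the Kottwitz condition of signature `(1, n−1)`); [Liu2021] Remark C.2 p. 108 and p. 136 (`n = 2`: «of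
signature `(1,1)` at `τ₁` and `(2,0)` elsewhere»)).  Let `σ` be a fixed-point-free involution on a finite set `ι` of «embeddings» (complex conjugation
`τ ↦ τ ∘ c` on the embeddings of a CM field), `{i₀, σ i₀}` a distinguished pair (the embeddings over the archimedean place of signature `(1,1)`),
and `D ⊆ ι` a `σ`-INDEPENDENT subset (`i ∈ D ⇒ σ i ∉ D`: the embeddings inducing ONE of two conjugate finite places `c•w ≠ w`) containing `σ i₀`.
(§1) There is a FRAME: a CM type `Φ ∋ i₀` (`i ∈ Φ ↔ σ i ∉ Φ`) containing `D ∖ {σ i₀}` (choose `i₀`, then `D ∖ {σ i₀}`, then one member of every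
remaining pair by a numbering).  (§2) For ANY signature function `m` with `m (σ i₀) = 1` and `m = 0` on `Φ` off the pair, the `D`-block count is
`∑_{i ∈ D} m i = 1` («the `c•w`-block of `Lie A` is a line»); if moreover `m i₀ = 1` and `m = 2` off `Φ` off the pair, the conjugate block has
`∑_{i ∈ σ(D)} m i = 2·#D − 1`.  (§3) The embedding costume: for a CM number field `F` and any field `K` of characteristic `0`, precomposition with
`complexConj F` is a fixed-point-free involution of `F →+* K`, so §1–§2 apply verbatim to `ι := F →+* K`.

MAIN STATEMENTS.  §1 **`exists_cmType_frame`**; §2 **`sum_signature_block_eq_one`**, **`sum_signature_conjBlock_eq`**; §3 `comp_complexConj_comp_complexConj`,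
`comp_complexConj_ne_self`, **`exists_cmType_frame_embeddings`**, **`sum_signature_block_eq_one_embeddings`**.

## References
* [RapoportSmithlingZhang2020Diagonal] M. Rapoport, B. Smithling, W. Zhang, *Arithmetic diagonal cycles on unitary Shimura varieties*, Compos. Math.
  156 (2020), §3.2 p. 10, §4.1 (4.6) p. 16 and p. 17.
* [Liu2021] Y. Liu, *Fourier–Jacobi cycles and arithmetic relative trace formula*, Camb. J. Math. 9 (2021), Remark C.2 p. 108, p. 136.
* [Kottwitz1992] R. Kottwitz, *Points on some Shimura varieties over finite fields*, JAMS 5 (1992), §5 p. 390 (the determinant condition).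
-/

set_option autoImplicit false

open Finset NumberField

namespace Literature.NumberTheory.ComplexMultiplication

/-! ### §1 The frame: a CM type through `i₀` containing a given independent set -/

section Abstract

variable {ι : Type*} [Fintype ι] [DecidableEq ι] (σ : ι → ι)

/-- **THE FRAME CM TYPE EXISTS**: for a fixed-point-free involution `σ`, a point `i₀` and a `σ`-independent finite set `D` not containing `i₀`,
there is a CM type `Φ` (`i ∈ Φ ↔ σ i ∉ Φ`) with `i₀ ∈ Φ` and `D ∖ {σ i₀} ⊆ Φ`.  (RSZ: the auxiliary CM type `Φ ∋ φ₀`, chosen adapted to the place.)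
[cite: RapoportSmithlingZhang2020Diagonal, §3.2 p. 10] -/
theorem exists_cmType_frame (hσ : ∀ i, σ (σ i) = i) (hσ' : ∀ i, σ i ≠ i) (i₀ : ι) (D : Finset ι)
    (hD : ∀ i ∈ D, σ i ∉ D) (hi₀ : i₀ ∉ D) :
    ∃ Φ : Finset ι, i₀ ∈ Φ ∧ (∀ i, i ∈ Φ ↔ σ i ∉ Φ) ∧ ∀ i ∈ D, i ≠ σ i₀ → i ∈ Φ := by
  classical
  -- the independent core `Φ₀ := {i₀} ∪ (D ∖ {σ i₀})`
  set Φ₀ : Finset ι := insert i₀ (D.erase (σ i₀)) with hΦ₀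
  have hcore : ∀ i ∈ Φ₀, σ i ∉ Φ₀ := by
    intro i hi hσi
    rw [hΦ₀, mem_insert, mem_erase] at hi hσi
    rcases hi with rfl | ⟨hi1, hi2⟩
    · rcases hσi with h | ⟨h1, _⟩
      · exact hσ' _ h
      · exact h1 rfl
    · rcases hσi with h | ⟨_, h2⟩
      · exact hi1 (by rw [← h, hσ])
      · exact hD _ hi2 h2
  -- a numbering to choose one member of every remaining pair
  obtain ⟨r, hr⟩ : ∃ r : ι → ℕ, Function.Injective r :=
    ⟨fun i => (Fintype.equivFin ι i : ℕ), fun i j h => (Fintype.equivFin ι).injective (Fin.ext h)⟩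
  refine ⟨Φ₀ ∪ (univ.filter fun i => i ∉ Φ₀ ∧ σ i ∉ Φ₀ ∧ r i < r (σ i)), ?_, ?_, ?_⟩
  · exact mem_union_left _ (by rw [hΦ₀]; exact mem_insert_self _ _)
  · intro i
    simp only [mem_union, mem_filter, mem_univ, true_and, hσ]
    constructor
    · rintro (hi | ⟨hi1, hi2, hi3⟩)
      · rintro (h | ⟨h1, h2, h3⟩)
        · exact hcore i hi h
        · exact h2 hi
      · rintro (h | ⟨h1, h2, h3⟩)
        · exact hi2 h
        · exact lt_asymm hi3 h3
    · intro h
      by_cases hi : i ∈ Φ₀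
      · exact Or.inl hi
      · right
        refine ⟨hi, fun h' => h (Or.inl h'), ?_⟩
        rcases lt_trichotomy (r i) (r (σ i)) with hlt | heq | hgt
        · exact hlt
        · exact absurd (hr heq).symm (hσ' i)
        · exact absurd (Or.inr ⟨fun h' => h (Or.inl h'), hi, hgt⟩) h
  · intro i hi hne
    exact mem_union_left _ (by rw [hΦ₀, mem_insert, mem_erase]; exact Or.inr ⟨hne, hi⟩)

/-! ### §2 The two block counts -/

omit [Fintype ι] in
/-- **THE `D`-BLOCK IS A LINE**: if `D` is `σ`-independent, `σ i₀ ∈ D`, `Φ ⊇ D ∖ {σ i₀}`, `m (σ i₀) = 1` and `m = 0` on `Φ` off the pair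
`{i₀, σ i₀}`, then `∑_{i ∈ D} m i = 1` — the (S-T) count `h1` («signature `(1, n−1)` at the place», `n = 2`).
[cite: RapoportSmithlingZhang2020Diagonal, §4.1 (4.6) p. 16 and p. 17] [cite: Liu2021, p. 136] -/
theorem sum_signature_block_eq_one (hσ : ∀ i, σ (σ i) = i) (i₀ : ι) (D Φ : Finset ι) (m : ι → ℕ)
    (hD : ∀ i ∈ D, σ i ∉ D) (hi₀D : σ i₀ ∈ D) (hΦD : ∀ i ∈ D, i ≠ σ i₀ → i ∈ Φ)
    (hm₁ : m (σ i₀) = 1) (hm₀ : ∀ i ∈ Φ, i ≠ i₀ → i ≠ σ i₀ → m i = 0) :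
    ∑ i ∈ D, m i = 1 := by
  have hi₀ : i₀ ∉ D := by have := hD _ hi₀D; rwa [hσ] at this
  rw [← Finset.add_sum_erase D m hi₀D, hm₁, Finset.sum_eq_zero, add_zero]
  intro i hi
  rw [mem_erase] at hi
  exact hm₀ i (hΦD i hi.2 hi.1) (fun h => hi₀ (h ▸ hi.2)) hi.1

omit [Fintype ι] in
/-- **THE CONJUGATE BLOCK HAS CODIMENSION ONE**: under the same hypotheses plus `Φ` a CM type, `m i₀ = 1` and `m = 2` off `Φ` off the pair,
`∑_{i ∈ σ(D)} m i = 2·#D − 1` (the frame block `A[w^∞]` has dimension `2d_w − 1`).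
[cite: RapoportSmithlingZhang2020Diagonal, §3.2 p. 10 and §4.1 p. 17] -/
theorem sum_signature_conjBlock_eq (hσ : ∀ i, σ (σ i) = i) (i₀ : ι) (D Φ : Finset ι) (m : ι → ℕ)
    (hD : ∀ i ∈ D, σ i ∉ D) (hi₀D : σ i₀ ∈ D) (hΦ : ∀ i, i ∈ Φ ↔ σ i ∉ Φ) (hΦD : ∀ i ∈ D, i ≠ σ i₀ → i ∈ Φ)
    (hm₁ : m i₀ = 1) (hm₂ : ∀ i ∉ Φ, i ≠ i₀ → i ≠ σ i₀ → m i = 2) :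
    ∑ i ∈ D.image σ, m i = 2 * D.card - 1 := by
  have hinj : Function.Injective σ := fun a b h => by rw [← hσ a, h, hσ]
  have hi₀ : i₀ ∉ D := by have := hD _ hi₀D; rwa [hσ] at this
  rw [Finset.sum_image (fun a _ b _ h => hinj h), ← Finset.add_sum_erase D _ hi₀D, hσ, hm₁]
  have hrest : ∑ x ∈ D.erase (σ i₀), m (σ x) = ∑ _x ∈ D.erase (σ i₀), 2 := by
    refine Finset.sum_congr rfl fun i hi => ?_
    rw [mem_erase] at hi
    refine hm₂ (σ i) ?_ ?_ ?_
    · exact (hΦ i).1 (hΦD i hi.2 hi.1)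
    · intro h; exact hi.1 (by rw [← h, hσ])
    · intro h; exact hi₀ (hinj h ▸ hi.2)
  rw [hrest, Finset.sum_const, smul_eq_mul, Finset.card_erase_of_mem hi₀D]
  have hpos : 0 < D.card := Finset.card_pos.2 ⟨_, hi₀D⟩
  omega

end Abstract

/-! ### §3 The embedding costume: `τ ↦ τ ∘ c` on `F →+* K` -/

section Embeddings

variable {F : Type*} [Field F] [NumberField F] [IsCMField F] {K : Type*} [Field K]

/-- `(τ ∘ c) ∘ c = τ`: precomposition with complex conjugation is an involution of the embeddings `F →+* K`. [cite: RapoportSmithlingZhang2020Diagonal, §3.2 p. 10] -/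
theorem comp_complexConj_comp_complexConj (τ : F →+* K) :
    (τ.comp ((IsCMField.complexConj F : F ≃ₐ[↥(maximalRealSubfield F)] F) : F →+* F)).comp
        ((IsCMField.complexConj F : F ≃ₐ[↥(maximalRealSubfield F)] F) : F →+* F) = τ := by
  ext x
  simp only [RingHom.coe_comp, RingHom.coe_coe, Function.comp_apply, IsCMField.complexConj_apply_apply]

/-- `τ ∘ c ≠ τ`: the involution is fixed-point free (`c ≠ 1` and `τ` is injective). [cite: RapoportSmithlingZhang2020Diagonal, §3.2 p. 10] -/
theorem comp_complexConj_ne_self (τ : F →+* K) :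
    τ.comp ((IsCMField.complexConj F : F ≃ₐ[↥(maximalRealSubfield F)] F) : F →+* F) ≠ τ := by
  intro h
  apply IsCMField.complexConj_ne_one F
  ext x
  have hx := RingHom.congr_fun h x
  simp only [RingHom.coe_comp, RingHom.coe_coe, Function.comp_apply] at hx
  exact τ.injective hx

/-- **THE FRAME CM TYPE of embeddings `F →+* K`** through `τ₀`, containing a conjugation-independent set `D ∌ τ₀` off `τ₀ ∘ c`
(§1 in the embedding costume; `K = ℂ`: a CM type of `F` in the usual sense; `K = F̄_w`: its `p`-adic avatar).
[cite: RapoportSmithlingZhang2020Diagonal, §3.2 p. 10] -/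
theorem exists_cmType_frame_embeddings [CharZero K] (τ₀ : F →+* K) (D : Finset (F →+* K))
    (hD : ∀ τ ∈ D, τ.comp ((IsCMField.complexConj F : F ≃ₐ[↥(maximalRealSubfield F)] F) : F →+* F) ∉ D) (hτ₀ : τ₀ ∉ D) :
    ∃ Φ : Finset (F →+* K), τ₀ ∈ Φ ∧
      (∀ τ, τ ∈ Φ ↔ τ.comp ((IsCMField.complexConj F : F ≃ₐ[↥(maximalRealSubfield F)] F) : F →+* F) ∉ Φ) ∧
      ∀ τ ∈ D, τ ≠ τ₀.comp ((IsCMField.complexConj F : F ≃ₐ[↥(maximalRealSubfield F)] F) : F →+* F) → τ ∈ Φ := by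
  classical
  exact exists_cmType_frame _ comp_complexConj_comp_complexConj comp_complexConj_ne_self τ₀ D hD hτ₀

/-- **THE `D`-BLOCK COUNT for embeddings** (§2 in the embedding costume): `∑_{τ ∈ D} m τ = 1` — served to the (S-T) socket as `h1` once GEN sets
`D := {τ ∣ τ induces c•w}`, `τ₀ :=` the structural embedding into `F̄_w` (inducing `w`) and `m :=` the Kottwitz signature of the frame `Φ`.
[cite: RapoportSmithlingZhang2020Diagonal, §4.1 (4.6) p. 16 and p. 17] [cite: Liu2021, p. 136] -/
theorem sum_signature_block_eq_one_embeddings (τ₀ : F →+* K) (D Φ : Finset (F →+* K)) (m : (F →+* K) → ℕ)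
    (hD : ∀ τ ∈ D, τ.comp ((IsCMField.complexConj F : F ≃ₐ[↥(maximalRealSubfield F)] F) : F →+* F) ∉ D)
    (hτ₀D : τ₀.comp ((IsCMField.complexConj F : F ≃ₐ[↥(maximalRealSubfield F)] F) : F →+* F) ∈ D)
    (hΦD : ∀ τ ∈ D, τ ≠ τ₀.comp ((IsCMField.complexConj F : F ≃ₐ[↥(maximalRealSubfield F)] F) : F →+* F) → τ ∈ Φ)
    (hm₁ : m (τ₀.comp ((IsCMField.complexConj F : F ≃ₐ[↥(maximalRealSubfield F)] F) : F →+* F)) = 1)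
    (hm₀ : ∀ τ ∈ Φ, τ ≠ τ₀ → τ ≠ τ₀.comp ((IsCMField.complexConj F : F ≃ₐ[↥(maximalRealSubfield F)] F) : F →+* F) → m τ = 0) :
    ∑ τ ∈ D, m τ = 1 := by
  classical
  exact sum_signature_block_eq_one _ comp_complexConj_comp_complexConj τ₀ D Φ m hD hτ₀D hΦD hm₁ hm₀

end Embeddings

end Literature.NumberTheory.ComplexMultiplication
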